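import Mathlib.Analysis.Calculus.ImplicitContDiff
import Mathlib.Analysis.Calculus.FDeriv.Analytic
import Mathlib.Analysis.Complex.Basic
import Mathlib.Algebra.Polynomial.Eval.Defs
import Literature.NumberTheory.Transcendental.AnalytificationImplicit
import HarnessLib

/-!
# Holomorphic root functions of `G(s, Y) = 0` at an étale point (Puiseux theory, analytic input)

Topic `Literature/FieldTheory/AlgClosed` (the analytic input of the convergence half of Puiseux's
theorem, used with `PuiseuxEtaleShift.lean`). For a field `K` with an embedding `K → ℂ`
(`Algebra K ℂ`) and a bivariate polynomial `G ∈ K[s][Y]`, write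
`G(s, W) := ((G.map (eval₂RingHom (algebraMap K ℂ) s)).eval W` for its complex evaluation. If
`G(s₀, u₀) = 0` and `∂_Y G(s₀, u₀) ≠ 0` then there is a function `ρ : ℂ → ℂ`, holomorphic (indeed
analytic) near `s₀`, with `ρ(s₀) = u₀` and `G(s, ρ(s)) = 0` for `s` near `s₀` — the holomorphic
implicit function theorem (Mathlib's `ContDiffAt.implicitFunction` in smoothness `ω`) applied to
the polynomial map `(s, W) ↦ G(s, W)`. We also record the evaluation of a composed (shifted)
polynomial `G(s, T(s) + sᴺ·W)`.

## Main statements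

* `Literature.FieldTheory.AlgClosed.eval_toMvPolynomial`: complex evaluation of `G ∈ K[s][Y]`
  through `MvPolynomial (Fin 2) ℂ`.
* `Literature.FieldTheory.AlgClosed.exists_holomorphic_root`: the root function at an étale point.
* `Literature.FieldTheory.AlgClosed.eval_comp_shift`: `G(s, T(s) + sᴺ W)` is the evaluation of
  `G.comp (C T + C (X ^ N) * X)`.

## References

* R. C. Gunning, H. Rossi, *Analytic functions of several complex variables* (1965), Ch. I §B,
  Thm. 9 (holomorphic implicit function theorem). [folklore]
* J. Kollár, *Lectures on Resolution of Singularities* (2007), 1.94–1.95. [Kollar2007]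
-/

noncomputable section

namespace Literature.FieldTheory.AlgClosed

open Polynomial Filter Topology
open scoped ContDiff

variable {K : Type*} [Field K] [Algebra K ℂ]

/-! ### Complex evaluation of `K[s][Y]` through `MvPolynomial (Fin 2) ℂ` -/

/-- The complex evaluation `G(s, W)` of `G ∈ K[s][Y]` is the evaluation at `![s, W]` of the image
of `G` in `MvPolynomial (Fin 2) ℂ` (`s ↦ X 0`, `Y ↦ X 1`). [folklore] -/
theorem eval_toMvPolynomial (G : K[X][X]) (s W : ℂ) :
    MvPolynomial.eval ![s, W]
      (Polynomial.eval₂ (Polynomial.eval₂RingHom (MvPolynomial.C.comp (algebraMap K ℂ))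
        (MvPolynomial.X (0 : Fin 2))) (MvPolynomial.X 1) G) =
      (G.map (Polynomial.eval₂RingHom (algebraMap K ℂ) s)).eval W := by
  -- both sides are ring homomorphisms in `G`; compare them on `C a` and `X`
  set φ : K[X][X] →+* MvPolynomial (Fin 2) ℂ :=
    Polynomial.eval₂RingHom (Polynomial.eval₂RingHom (MvPolynomial.C.comp (algebraMap K ℂ))
      (MvPolynomial.X 0)) (MvPolynomial.X 1) with hφ
  set L : K[X][X] →+* ℂ := (MvPolynomial.eval ![s, W]).comp φ with hL
  set R : K[X][X] →+* ℂ := Polynomial.eval₂RingHom (Polynomial.eval₂RingHom (algebraMap K ℂ) s) W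
    with hR
  have hinner : ∀ a : K[X], MvPolynomial.eval ![s, W]
      (Polynomial.eval₂ (MvPolynomial.C.comp (algebraMap K ℂ)) (MvPolynomial.X 0) a) =
      Polynomial.eval₂ (algebraMap K ℂ) s a := by
    intro a
    induction a using Polynomial.induction_on' with
    | add p q hp hq => simp only [Polynomial.eval₂_add, map_add, hp, hq]
    | monomial n c =>
      simp only [Polynomial.eval₂_monomial, map_mul, map_pow, RingHom.comp_apply,
        MvPolynomial.eval_C, MvPolynomial.eval_X, Matrix.cons_val_zero]
  have key : L = R := by
    refine Polynomial.ringHom_ext (fun a => ?_) ?_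
    · rw [hL, hR, RingHom.comp_apply, hφ, Polynomial.coe_eval₂RingHom, Polynomial.eval₂_C,
        Polynomial.coe_eval₂RingHom, Polynomial.coe_eval₂RingHom, Polynomial.eval₂_C,
        Polynomial.coe_eval₂RingHom]
      exact hinner a
    · rw [hL, hR, RingHom.comp_apply, hφ, Polynomial.coe_eval₂RingHom, Polynomial.eval₂_X,
        Polynomial.coe_eval₂RingHom, Polynomial.eval₂_X, MvPolynomial.eval_X]
      rfl
  have := congrArg (fun ψ : K[X][X] →+* ℂ => ψ G) key
  simp only [hL, hR, RingHom.comp_apply, Polynomial.coe_eval₂RingHom] at this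
  rw [Polynomial.eval_map]
  exact this

/-- The `Y`-derivative commutes with the passage to `MvPolynomial (Fin 2) ℂ`: the image of
`∂_Y G` is `pderiv 1` of the image of `G`. [folklore] -/
theorem toMvPolynomial_derivative (G : K[X][X]) :
    Polynomial.eval₂ (Polynomial.eval₂RingHom (MvPolynomial.C.comp (algebraMap K ℂ))
        (MvPolynomial.X (0 : Fin 2))) (MvPolynomial.X (1 : Fin 2)) (Polynomial.derivative G) =
      MvPolynomial.pderiv 1 (Polynomial.eval₂ (Polynomial.eval₂RingHom
        (MvPolynomial.C.comp (algebraMap K ℂ)) (MvPolynomial.X (0 : Fin 2))) (MvPolynomial.X 1) G) := by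
  have hψ1 : ∀ a : K[X], MvPolynomial.pderiv (1 : Fin 2)
      (Polynomial.eval₂ (MvPolynomial.C.comp (algebraMap K ℂ)) (MvPolynomial.X 0) a) = 0 := by
    intro a
    induction a using Polynomial.induction_on' with
    | add p q hp hq => simp only [Polynomial.eval₂_add, map_add, hp, hq, add_zero]
    | monomial n c =>
      rw [Polynomial.eval₂_monomial]
      simp [MvPolynomial.pderiv_X]
  induction G using Polynomial.induction_on' with
  | add p q hp hq => simp only [Polynomial.eval₂_add, map_add, hp, hq]
  | monomial n c =>
    simp only [Polynomial.derivative_monomial, Polynomial.eval₂_monomial, Polynomial.coe_eval₂RingHom,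
      Derivation.leibniz, Derivation.leibniz_pow, hψ1, MvPolynomial.pderiv_X,
      Polynomial.eval₂_mul, Polynomial.eval₂_natCast, Pi.single_eq_same, smul_eq_mul, mul_one,
      nsmul_eq_mul]
    ring

/-! ### The holomorphic root function at an étale point -/

/-- **Holomorphic implicit function theorem for `G(s, Y) = 0`.** If `G(s₀, u₀) = 0` and
`∂_Y G(s₀, u₀) ≠ 0` (complex evaluation of `G ∈ K[s][Y]`), there is `ρ : ℂ → ℂ`, analytic at `s₀`,
with `ρ s₀ = u₀` and `G(s, ρ s) = 0` for all `s` near `s₀`. [folklore] -/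
theorem exists_holomorphic_root (G : K[X][X]) {s₀ u₀ : ℂ}
    (h0 : (G.map (Polynomial.eval₂RingHom (algebraMap K ℂ) s₀)).eval u₀ = 0)
    (h1 : ((Polynomial.derivative G).map (Polynomial.eval₂RingHom (algebraMap K ℂ) s₀)).eval u₀ ≠ 0) :
    ∃ ρ : ℂ → ℂ, ρ s₀ = u₀ ∧ AnalyticAt ℂ ρ s₀ ∧
      ∀ᶠ s in 𝓝 s₀, (G.map (Polynomial.eval₂RingHom (algebraMap K ℂ) s)).eval (ρ s) = 0 := by
  set G₂ : MvPolynomial (Fin 2) ℂ := Polynomial.eval₂ (Polynomial.eval₂RingHom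
    (MvPolynomial.C.comp (algebraMap K ℂ)) (MvPolynomial.X (0 : Fin 2))) (MvPolynomial.X 1) G with hG₂
  set e : (ℂ × ℂ) ≃L[ℂ] (Fin 2 → ℂ) := (ContinuousLinearEquiv.finTwoArrow ℂ ℂ).symm with he
  have heapp : ∀ p : ℂ × ℂ, e p = ![p.1, p.2] := fun p => by
    rw [he]
    rfl
  set f : ℂ × ℂ → ℂ := fun p => MvPolynomial.eval (e p) G₂ with hf
  have hfapp : ∀ p : ℂ × ℂ, f p = (G.map (Polynomial.eval₂RingHom (algebraMap K ℂ) p.1)).eval p.2 := by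
    intro p
    rw [hf]
    change MvPolynomial.eval (e p) G₂ = _
    rw [heapp, hG₂, eval_toMvPolynomial]
  have hfcomp : f = (fun w => MvPolynomial.eval w G₂) ∘ e := rfl
  have cdf : ContDiffAt ℂ ω f (s₀, u₀) := by
    rw [hfcomp]
    exact (Literature.NumberTheory.Transcendental.contDiffAt_eval G₂ _).comp _ e.contDiff.contDiffAt
  have hfd : HasFDerivAt f ((∑ i, MvPolynomial.eval (e (s₀, u₀)) (MvPolynomial.pderiv i G₂) •
      (ContinuousLinearMap.proj i : (Fin 2 → ℂ) →L[ℂ] ℂ)) ∘L (e : (ℂ × ℂ) →L[ℂ] (Fin 2 → ℂ)))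
      (s₀, u₀) := by
    rw [hfcomp]
    exact (Literature.NumberTheory.Transcendental.hasFDerivAt_eval G₂ _).comp _ e.hasFDerivAt
  -- the partial derivative in `Y` is multiplication by `c = ∂_Y G(s₀, u₀) ≠ 0`
  set c : ℂ := MvPolynomial.eval ![s₀, u₀] (MvPolynomial.pderiv 1 G₂) with hc
  have hc1 : c = ((Polynomial.derivative G).map (Polynomial.eval₂RingHom (algebraMap K ℂ) s₀)).eval u₀ := by
    rw [hc, hG₂, ← toMvPolynomial_derivative, eval_toMvPolynomial]
  have hc0 : c ≠ 0 := by rw [hc1]; exact h1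
  have hinr : fderiv ℂ f (s₀, u₀) ∘L ContinuousLinearMap.inr ℂ ℂ ℂ =
      ((ContinuousLinearEquiv.unitsEquivAut ℂ (Units.mk0 c hc0) : ℂ ≃L[ℂ] ℂ) : ℂ →L[ℂ] ℂ) := by
    rw [hfd.fderiv]
    ext
    simp [heapp, Fin.sum_univ_two, hc]
  have if₂ : (fderiv ℂ f (s₀, u₀) ∘L ContinuousLinearMap.inr ℂ ℂ ℂ).IsInvertible := by
    rw [hinr]
    exact ⟨_, rfl⟩
  have hω : (ω : ℕ∞ω) ≠ 0 := by simp
  refine ⟨cdf.implicitFunction hω if₂, cdf.implicitFunction_apply_self hω if₂,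
    (cdf.contDiffAt_implicitFunction hω if₂).analyticAt, ?_⟩
  have hev := cdf.eventually_apply_implicitFunction hω if₂
  filter_upwards [hev] with s hs
  have hf0 : f (s₀, u₀) = 0 := by rw [hfapp]; exact h0
  rw [hf0, hfapp] at hs
  exact hs

/-! ### Evaluating the shifted polynomial -/

/-- Evaluation of a polynomial coefficient `T ∈ K[s]` at a complex point. [folklore] -/
theorem eval₂RingHom_C_eval (T : K[X]) (s W : ℂ) :
    ((Polynomial.C T : K[X][X]).map (Polynomial.eval₂RingHom (algebraMap K ℂ) s)).eval W =
      Polynomial.eval₂ (algebraMap K ℂ) s T := by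
  rw [Polynomial.map_C, Polynomial.eval_C, Polynomial.coe_eval₂RingHom]

/-- `G(s, T(s) + sᴺ·W)` is the complex evaluation at `(s, W)` of the shifted polynomial
`G.comp (C T + C (X ^ N) * X)`. [cite: Kollar2007, 1.95] -/
theorem eval_comp_shift (G : K[X][X]) (T : K[X]) (N : ℕ) (s W : ℂ) :
    ((G.comp (Polynomial.C T + Polynomial.C ((Polynomial.X : K[X]) ^ N) * Polynomial.X)).map
        (Polynomial.eval₂RingHom (algebraMap K ℂ) s)).eval W =
      (G.map (Polynomial.eval₂RingHom (algebraMap K ℂ) s)).eval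
        (Polynomial.eval₂ (algebraMap K ℂ) s T + s ^ N * W) := by
  rw [Polynomial.map_comp, Polynomial.eval_comp]
  congr 1
  simp only [Polynomial.map_add, Polynomial.map_mul, Polynomial.map_C, Polynomial.map_X,
    Polynomial.eval_add, Polynomial.eval_mul, Polynomial.eval_C, Polynomial.eval_X,
    Polynomial.coe_eval₂RingHom, Polynomial.eval₂_X_pow]

/-- The multiplier identity `G.comp (…) = C (X ^ e) * H` evaluated: `G(s, T(s) + sᴺ W) = sᵉ · H(s, W)`.
[cite: Kollar2007, 1.95] -/
theorem eval_shift_of_comp_eq (G H : K[X][X]) (T : K[X]) (N e : ℕ)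
    (hGH : G.comp (Polynomial.C T + Polynomial.C ((Polynomial.X : K[X]) ^ N) * Polynomial.X) =
      Polynomial.C ((Polynomial.X : K[X]) ^ e) * H) (s W : ℂ) :
    (G.map (Polynomial.eval₂RingHom (algebraMap K ℂ) s)).eval
        (Polynomial.eval₂ (algebraMap K ℂ) s T + s ^ N * W) =
      s ^ e * (H.map (Polynomial.eval₂RingHom (algebraMap K ℂ) s)).eval W := by
  rw [← eval_comp_shift, hGH, Polynomial.map_mul, Polynomial.map_C, Polynomial.eval_mul,
    Polynomial.eval_C, Polynomial.coe_eval₂RingHom, Polynomial.eval₂_X_pow]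

end Literature.FieldTheory.AlgClosed

end
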